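import Summits.ResolutionOfSingularities.ResolutionOfSingularities.Theorems.FrobeniusClosingSteerRadicandIsolatedAscent
import Summits.ResolutionOfSingularities.ResolutionOfSingularities.Theorems.FrobeniusClosingSteerWords06SteeredVocab
import Literature.AlgebraicGeometry.Motives.VarietiesRegularProofs
import Mathlib.RingTheory.Etale.Basic
import Mathlib.RingTheory.Localization.BaseChange
import Mathlib.RingTheory.Localization.LocalizationLocalization
import Mathlib.RingTheory.IsTensorProduct
import HarnessLib

/-!
# Crux `Steer` (stmt-ResolutionOfSingularities-16345 ⇒ IsolatedForcedTermination stmt-16343), chain W4.1, K-side K3-c = K-GG4 (a):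
# ISOLATEDNESS OF THE `p`-RADICAND GERM ASCENDS ALONG AN ÉTALE-LOCAL EXTENSION `S → A_𝔫` (Theses-free, definition-free)

OURS (campaign `res-hironaka`, rung L ★L-G4, slot W4.1; seat res-D-pv-040 g8 on res-L0-w41-plan-1 RULING 250 (a) / 251 (f) / 252 (f),
custody res-plan-2 DEAL #45; statement shape and proof plan res-L0-w41-stub-3 (STATUS 2026-08-27T18:33:33Z (2)(3)); consumer res-D-lib-1's
K3-BLUEPRINT item (5), file name `…SteerIsolatedEtaleLift` from the blueprint; `--supports stmt-ResolutionOfSingularities-16345 --as helper`).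
Replaces the role of no printed item and is NOT a statement of the manuscript under review [claim: Hironaka2017, status: under-review];
AI-produced kernel plumbing over classical inputs, weaker than expert review; nothing here is progress on resolution of singularities in
characteristic `p` by itself.

## What is proved (tree words `Words06SteeredVocab.RadicandRing S p f = S[T]/(T^p − f)`, `HasIsolatedSingularity`)
* `hasIsolatedSingularity_of_ringEquiv` — `HasIsolatedSingularity` is invariant under ring isomorphisms (plumbing; `JacobianRegularLocus`).
* `hasIsolatedSingularity_tensor` — for a FINITE ÉTALE `S`-algebra `A` (`S` Noetherian), a prime `𝔫 ⊂ A`, any `IsLocalization.AtPrime`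
  model `S'` of `A_𝔫` (an `S`-algebra through `A`) and `f ∈ S`: `HasIsolatedSingularity (S[T]/(T^p − f)) → HasIsolatedSingularity
  (S' ⊗_S S[T]/(T^p − f))`.
* **`hasIsolatedSingularity_radicand_of_etale_localization`** — the same with the conclusion `HasIsolatedSingularity (S'[T]/(T^p − f))`
  (`RadicandRing S' p (algebraMap S S' f)`), i.e. K3-c EXACTLY in stub-3's robust non-local shape: hypotheses `[IsNoetherianRing S]
  [Algebra.Etale S A] [Module.Finite S A] (𝔫 : Ideal A) [𝔫.IsPrime] [IsLocalization.AtPrime S' 𝔫] [IsScalarTower S A S']`, the →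
  direction ONLY (the one (R1) consumes); no locality of `S`, no characteristic hypothesis, no fraction field.

## Proof (stub-3's three facts, all in the tree / Mathlib)
`R := S[T]/(T^p − f)`; `E := A ⊗_S R` is ÉTALE over `R` (Mathlib `Algebra.Etale.baseChange`, transported along `R ⊗_S A ≅ A ⊗_S R`) and
FINITE, hence integral; `T' := S' ⊗_S R` is the LOCALISATION of `E` at the image of `A ∖ 𝔫`: the square `A → S'`, `E → T'` is a pushout
by pasting (`Algebra.IsPushout.comp_iff` on `S → A → S'` with the tensor squares), and a pushout of a localisation is a localisation
(`Algebra.isLocalization_iff_isPushout`). For a prime `P'` of `T'` lying strictly below a prime: `q := P' ∩ E` lies strictly below a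
prime (`IsLocalization.orderEmbedding`), so `q ∩ R` is not maximal (`Ideal.isMaximal_of_isIntegral_of_isMaximal_comap`); `R_{q ∩ R}` is
regular by the hypothesis; regularity ASCENDS along the étale `R → E` to `E_q` (Stacks 00TV / EGA IV 6.5; tree
`Literature.AlgebraicGeometry.Motives.IsRegularLocalRing.of_etale`); and `T'_{P'} ≅ E_q` (localisation of a localisation,
`IsLocalization.isLocalization_isLocalization_atPrime_isLocalization` + `IsLocalization.algEquiv`). Finally `S'[T]/(T^p − f) ≅ S' ⊗_S R`
(`RadicandAscent.nonempty_baseChangeEquiv`, Mathlib `AdjoinRoot.tensorAlgEquiv`).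

[cite: StacksProject, Tag 00TV (étale ring maps; regularity of the fibres) and Tag 07BZ] [cite: Matsumura1987, Thm. 23.7 (ascent of regularity along
flat local maps with regular closed fibre)] bears_on: LADDER-RESOLUTION L ★L-G4 W4.1 (crux `Steer`, hNRW / K3 étale residue lift).
-/

noncomputable section

set_option linter.dupNamespace false

open IsLocalRing Polynomial TensorProduct

namespace Summit.ResolutionOfSingularities.ResolutionOfSingularities.Theorems.SwitchingDichotomy.IsolatedEtaleLift

open Literature.AlgebraicGeometry.Resolution
open Summit.ResolutionOfSingularities.ResolutionOfSingularities.Theorems.SwitchingDichotomy.Words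

/-- `HasIsolatedSingularity` is invariant under ring isomorphisms (`P ↦ e⁻¹ P`; regular loci correspond, tree
`mem_regularLocus_iff_of_ringEquiv`). OURS plumbing. (folklore) -/
theorem hasIsolatedSingularity_of_ringEquiv {R₁ R₂ : Type} [CommRing R₁] [CommRing R₂] (e : R₁ ≃+* R₂)
    (h : HasIsolatedSingularity R₁) : HasIsolatedSingularity R₂ := by
  intro P hP hlt
  have hlt' := RadicandAscent.exists_lt_comap_of_exists_lt e hlt
  haveI : (P.comap (e : R₁ →+* R₂)).IsPrime := Ideal.comap_isPrime _ _
  have hreg : IsRegularLocalRing (Localization.AtPrime (P.comap (e : R₁ →+* R₂))) := h _ hlt'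
  have hmem : PrimeSpectrum.comap (e : R₁ →+* R₂) ⟨P, hP⟩ ∈ regularLocus R₁ := by
    rw [mem_regularLocus]; exact hreg
  have := (mem_regularLocus_iff_of_ringEquiv e ⟨P, hP⟩).mpr hmem
  rwa [mem_regularLocus] at this

/-- **Core (tensor form).** With `g = T^p − f`, `R = S[T]/(g)`, `E = A ⊗_S R` (étale and finite over `R`), the ring `T' = S' ⊗_S R` is the
localisation of `E` at the image of `A ∖ 𝔫`; hence, if `R` has an isolated singularity, so has `T'`: a prime `P' ⊂ T'` strictly below a
prime contracts to `q ⊂ E` strictly below a prime, `q ∩ R` is not maximal (integrality), `R_{q∩R}` is regular, and regularity ascends along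
the étale `R → E` to `E_q ≅ T'_{P'}` (Stacks 00TV; tree `IsRegularLocalRing.of_etale`). OURS. [cite: StacksProject, Tag 00TV] -/
theorem hasIsolatedSingularity_tensor {S A S' : Type} [CommRing S] [CommRing A] [CommRing S'] [IsNoetherianRing S]
    [Algebra S A] [Algebra.Etale S A] [Module.Finite S A]
    (𝔫 : Ideal A) [𝔫.IsPrime] [Algebra A S'] [IsLocalization.AtPrime S' 𝔫] [Algebra S S'] [IsScalarTower S A S']
    (p : ℕ) [Fact p.Prime] (f : S) (hisol : HasIsolatedSingularity (RadicandRing S p f)) :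
    HasIsolatedSingularity (S' ⊗[S] RadicandRing S p f) := by
  classical
  set g : S[X] := (X : S[X]) ^ p - C f with hg
  have hgmon : g.Monic := monic_X_pow_sub_C f (Fact.out : p.Prime).ne_zero
  -- `R = S[T]/(g)` (definitionally `RadicandRing S p f`), finite over `S`, Noetherian
  change HasIsolatedSingularity (AdjoinRoot g) at hisol
  change HasIsolatedSingularity (S' ⊗[S] AdjoinRoot g)
  haveI : Module.Finite S (AdjoinRoot g) := hgmon.finite_adjoinRoot
  haveI : IsNoetherianRing (AdjoinRoot g) := IsNoetherianRing.of_finite S _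
  -- `E = A ⊗_S R`, an `R`-algebra through the right factor; étale and finite over `R`
  letI algRE : Algebra (AdjoinRoot g) (A ⊗[S] AdjoinRoot g) := Algebra.TensorProduct.rightAlgebra
  letI algRT : Algebra (AdjoinRoot g) (S' ⊗[S] AdjoinRoot g) := Algebra.TensorProduct.rightAlgebra
  have ecomm : AdjoinRoot g ⊗[S] A ≃ₐ[AdjoinRoot g] A ⊗[S] AdjoinRoot g :=
    AlgEquiv.ofRingEquiv (f := (Algebra.TensorProduct.comm S (AdjoinRoot g) A).toRingEquiv) fun r => by
      change Algebra.TensorProduct.comm S (AdjoinRoot g) A (r ⊗ₜ[S] (1 : A)) = (1 : A) ⊗ₜ[S] r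
      exact Algebra.TensorProduct.comm_tmul S r (1 : A)
  haveI hEt : Algebra.Etale (AdjoinRoot g) (A ⊗[S] AdjoinRoot g) := Algebra.Etale.of_equiv ecomm
  haveI hFin : Module.Finite (AdjoinRoot g) (A ⊗[S] AdjoinRoot g) := Module.Finite.equiv ecomm.toLinearEquiv
  haveI : Algebra.IsIntegral (AdjoinRoot g) (A ⊗[S] AdjoinRoot g) := inferInstance
  -- `T' = S' ⊗_S R` is an `A`-algebra through `S'` (Mathlib's left action); make it an `E`-algebra by `A ⊗ R → S' ⊗ R`
  let ψ : A ⊗[S] AdjoinRoot g →ₐ[S] S' ⊗[S] AdjoinRoot g :=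
    Algebra.TensorProduct.map (IsScalarTower.toAlgHom S A S') (AlgHom.id S (AdjoinRoot g))
  letI algET : Algebra (A ⊗[S] AdjoinRoot g) (S' ⊗[S] AdjoinRoot g) := ψ.toRingHom.toAlgebra
  have hψ : ∀ x, algebraMap (A ⊗[S] AdjoinRoot g) (S' ⊗[S] AdjoinRoot g) x = ψ x := fun _ => rfl
  haveI : IsScalarTower A (A ⊗[S] AdjoinRoot g) (S' ⊗[S] AdjoinRoot g) :=
    IsScalarTower.of_algebraMap_eq fun a => by
      rw [hψ, IsScalarTower.algebraMap_apply A S' (S' ⊗[S] AdjoinRoot g)]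
      change algebraMap S' _ (algebraMap A S' a) = ψ (a ⊗ₜ[S] (1 : AdjoinRoot g))
      rw [Algebra.TensorProduct.map_tmul]
      rfl
  haveI : IsScalarTower (AdjoinRoot g) (A ⊗[S] AdjoinRoot g) (S' ⊗[S] AdjoinRoot g) :=
    IsScalarTower.of_algebraMap_eq fun r => by
      rw [hψ]
      change (1 : S') ⊗ₜ[S] r = ψ ((1 : A) ⊗ₜ[S] r)
      rw [Algebra.TensorProduct.map_tmul, map_one]
      rfl
  haveI : IsScalarTower S (A ⊗[S] AdjoinRoot g) (S' ⊗[S] AdjoinRoot g) :=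
    IsScalarTower.of_algebraMap_eq fun s => by
      rw [hψ, IsScalarTower.algebraMap_apply S A (A ⊗[S] AdjoinRoot g)]
      change _ = ψ (algebraMap S A s ⊗ₜ[S] (1 : AdjoinRoot g))
      rw [Algebra.TensorProduct.map_tmul]
      rw [map_one, IsScalarTower.toAlgHom_apply, ← IsScalarTower.algebraMap_apply S A S']
      rfl
  -- pushout pasting: `T' = S' ⊗_S R = S' ⊗_A (A ⊗_S R)`
  have hpush : Algebra.IsPushout A S' (A ⊗[S] AdjoinRoot g) (S' ⊗[S] AdjoinRoot g) :=
    (Algebra.IsPushout.comp_iff (R := S) (S := A) (T := S') (R' := AdjoinRoot g) (S' := A ⊗[S] AdjoinRoot g)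
      (T' := S' ⊗[S] AdjoinRoot g)).mp inferInstance
  -- hence `T'` is the localisation of `E` at the image of `A ∖ 𝔫`
  have hloc : IsLocalization (Algebra.algebraMapSubmonoid (A ⊗[S] AdjoinRoot g) 𝔫.primeCompl)
      (S' ⊗[S] AdjoinRoot g) :=
    (Algebra.isLocalization_iff_isPushout (R := A) 𝔫.primeCompl S' (T := A ⊗[S] AdjoinRoot g)
      (B := S' ⊗[S] AdjoinRoot g)).mpr hpush.symm
  -- a non-maximal prime `P'` of `T'` and the prime `q = P' ∩ E`
  intro P' hP' hlt
  obtain ⟨Q, hQ, hPQ⟩ := hlt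
  set q : Ideal (A ⊗[S] AdjoinRoot g) := P'.comap (algebraMap (A ⊗[S] AdjoinRoot g) (S' ⊗[S] AdjoinRoot g)) with hqdef
  haveI hq : q.IsPrime := Ideal.comap_isPrime _ _
  set q' : Ideal (A ⊗[S] AdjoinRoot g) := Q.comap (algebraMap (A ⊗[S] AdjoinRoot g) (S' ⊗[S] AdjoinRoot g)) with hq'def
  haveI hq' : q'.IsPrime := Ideal.comap_isPrime _ _
  have hqq' : q < q' :=
    (IsLocalization.orderEmbedding (Algebra.algebraMapSubmonoid (A ⊗[S] AdjoinRoot g) 𝔫.primeCompl)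
      (S' ⊗[S] AdjoinRoot g)).lt_iff_lt.mpr hPQ
  -- `q ∩ R` is not maximal (`E` is integral over `R`), hence lies strictly below a prime
  have hqR : ∃ P'' : Ideal (AdjoinRoot g), P''.IsPrime ∧ q.under (AdjoinRoot g) < P'' := by
    have hnot : ¬ (q.under (AdjoinRoot g)).IsMaximal := fun hmax =>
      hqq'.ne ((Ideal.isMaximal_of_isIntegral_of_isMaximal_comap (R := AdjoinRoot g) q hmax).eq_of_le
        hq'.ne_top hqq'.le)
    obtain ⟨M, hM, hle⟩ := Ideal.exists_le_maximal (q.under (AdjoinRoot g)) (Ideal.IsPrime.ne_top inferInstance)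
    refine ⟨M, hM.isPrime, lt_of_le_of_ne hle ?_⟩
    rintro h; exact hnot (h ▸ hM)
  -- `R_{q ∩ R}` is regular (isolatedness of `R`), so `E_q` is regular (étale ascent, Stacks 00TV/07BZ)
  haveI hregR : IsRegularLocalRing (Localization.AtPrime (q.under (AdjoinRoot g))) := hisol _ hqR
  have hregE : IsRegularLocalRing (Localization.AtPrime q) :=
    Literature.AlgebraicGeometry.Motives.IsRegularLocalRing.of_etale (R := AdjoinRoot g) q
  -- `T'_{P'} = E_q` (localisation of a localisation)
  haveI : IsLocalization.AtPrime (Localization.AtPrime P') q :=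
    IsLocalization.isLocalization_isLocalization_atPrime_isLocalization
      (Algebra.algebraMapSubmonoid (A ⊗[S] AdjoinRoot g) 𝔫.primeCompl) (Localization.AtPrime P') P'
  haveI := hregE
  exact IsRegularLocalRing.of_ringEquiv
    (IsLocalization.algEquiv q.primeCompl (Localization.AtPrime q) (Localization.AtPrime P')).toRingEquiv

/-- **K3-c = K-GG4 (a): isolatedness of the `p`-radicand germ ASCENDS along an étale-local extension** (→ direction only).
Let `A` be a finite étale `S`-algebra (`S` Noetherian), `𝔫` a prime of `A`, `S' = A_𝔫` (any `IsLocalization.AtPrime` model,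
an `S`-algebra through `A`), `f ∈ S`. If `S[T]/(T^p − f)` has an isolated singularity (every non-maximal prime localises to a
regular local ring), so does `S'[T]/(T^p − f)`. Proof: `E = A ⊗_S S[T]/(T^p − f)` is étale and finite over `R = S[T]/(T^p − f)`
(base change); `S'[T]/(T^p − f) ≅ S' ⊗_S R` is the localisation of `E` at the image of `A ∖ 𝔫` (pushout pasting); a
non-maximal prime `P'` upstairs contracts to a prime `q ⊂ E` lying STRICTLY below another (localisation), so `q ∩ R` is not
maximal (`E/R` integral); `R_{q ∩ R}` is regular by hypothesis and regularity ascends to `E_q = (S' ⊗_S R)_{P'}` along the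
étale `R → E` (Stacks 00TV; tree `Literature…Motives.IsRegularLocalRing.of_etale`). No locality of `S`, no characteristic
hypothesis. (res-L0-w41-stub-3's shape and plan, res-D-lib-1's K3-BLUEPRINT item (5).) OURS. (folklore) -/
theorem hasIsolatedSingularity_radicand_of_etale_localization {S A S' : Type} [CommRing S] [CommRing A] [CommRing S']
    [IsNoetherianRing S] [Algebra S A] [Algebra.Etale S A] [Module.Finite S A]
    (𝔫 : Ideal A) [𝔫.IsPrime] [Algebra A S'] [IsLocalization.AtPrime S' 𝔫] [Algebra S S'] [IsScalarTower S A S']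
    (p : ℕ) [Fact p.Prime] (f : S) (hisol : HasIsolatedSingularity (RadicandRing S p f)) :
    HasIsolatedSingularity (RadicandRing S' p (algebraMap S S' f)) := by
  have h := hasIsolatedSingularity_tensor (S' := S') 𝔫 p f hisol
  have hg' : ((X : S[X]) ^ p - C f).map (algebraMap S S') = (X : S'[X]) ^ p - C (algebraMap S S' f) := by
    rw [Polynomial.map_sub, Polynomial.map_pow, Polynomial.map_X, Polynomial.map_C]
  obtain ⟨e⟩ := RadicandAscent.nonempty_baseChangeEquiv (S' := S') ((X : S[X]) ^ p - C f)
  rw [hg'] at e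
  exact hasIsolatedSingularity_of_ringEquiv e h


end Summit.ResolutionOfSingularities.ResolutionOfSingularities.Theorems.SwitchingDichotomy.IsolatedEtaleLift

end
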